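import Mathlib
import Literature.RingTheory.MvPolynomial.RuppertReducibleProofs

/-!
# Polynomial bookkeeping for row polynomials (infrastructure for `MomentParity.QuarticGate`,
line `recession-cone`, stmt-AnomalousDissipation-11464)

Pure `MvPolynomial` facts over a commutative ring / `ℝ`, used to control the degree and the top
homogeneous component of the ROW POLYNOMIAL of a cylindrical test (`MomentParityQuarticGateRowPoly`):

* `eval_bind₁` — evaluation commutes with substitution;
* `isHomogeneous_bind₁`, `totalDegree_bind₁_le` — substituting LINEAR FORMS preserves homogeneity
  and does not raise the total degree;
* the degree drop `deg ∂ᵢφ ≤ deg φ − 1` is `Literature.RingTheory.MvPolynomial.Ruppert.totalDegree_pderiv_le`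
  (re-exported over `ℝ` as the registered `totalDegree_pderiv_le_real`);
* `totalDegree_sub_homogeneousComponent_le` — `deg (φ − φ_d) ≤ d − 1` when `deg φ ≤ d`;
* `totalDegree_bind₁_pderiv_mul_le` — the degree count `deg ((∂ᵢφ ∘ ℓ) · ψ) ≤ e` whenever
  `deg φ + deg ψ ≤ e + 1` (including the degenerate constant case);
* `homogeneousComponent_eq_of_add` — reading off the top component from a decomposition
  `Q = Q_top + Q_low`.
-/

namespace Summit.AnomalousDissipation.AnomalousDissipation.Theorems.MomentParityQuarticGate

open MvPolynomial

set_option linter.dupNamespace false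

variable {σ τ : Type*} {R : Type*} [CommSemiring R]

/-- Evaluation commutes with substitution: `(bind₁ ℓ φ)(x) = φ(ℓ₁(x), …, ℓₘ(x))`. [folklore] -/
theorem eval_bind₁ (x : τ → R) (ℓ : σ → MvPolynomial τ R) (φ : MvPolynomial σ R) :
    eval x (bind₁ ℓ φ) = eval (fun j => eval x (ℓ j)) φ := by
  have h := aeval_bind₁ x ℓ φ
  simpa only [aeval_eq_eval] using h

/-- Substituting homogeneous linear forms into a homogeneous polynomial of degree `k` gives a
homogeneous polynomial of degree `k`. [folklore] -/
theorem isHomogeneous_bind₁ {ℓ : σ → MvPolynomial τ R} (hℓ : ∀ j, (ℓ j).IsHomogeneous 1)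
    {φ : MvPolynomial σ R} {k : ℕ} (hφ : φ.IsHomogeneous k) : (bind₁ ℓ φ).IsHomogeneous k := by
  have h := hφ.eval₂ (C : R →+* MvPolynomial τ R) ℓ (fun r => isHomogeneous_C _ r) hℓ
  rw [one_mul] at h
  simpa only [bind₁, aeval_def, algebraMap_eq, coe_eval₂Hom] using h

/-- Substituting homogeneous linear forms does not raise the total degree. [folklore] -/
theorem totalDegree_bind₁_le {ℓ : σ → MvPolynomial τ R} (hℓ : ∀ j, (ℓ j).IsHomogeneous 1)
    (φ : MvPolynomial σ R) : (bind₁ ℓ φ).totalDegree ≤ φ.totalDegree := by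
  conv_lhs => rw [← sum_homogeneousComponent φ]
  rw [map_sum]
  refine totalDegree_finsetSum_le fun i hi => ?_
  exact (isHomogeneous_bind₁ hℓ (homogeneousComponent_isHomogeneous i φ)).totalDegree_le.trans
    (Nat.lt_succ_iff.1 (Finset.mem_range.1 hi))

/-- Removing the degree-`d` component of a polynomial of degree `≤ d` leaves degree `≤ d − 1`.
[folklore] -/
theorem totalDegree_sub_homogeneousComponent_le {S : Type*} [CommRing S] {φ : MvPolynomial σ S}
    {d : ℕ} (hφ : φ.totalDegree ≤ d) :
    (φ - homogeneousComponent d φ).totalDegree ≤ d - 1 := by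
  by_cases hd : φ.totalDegree < d
  · rw [homogeneousComponent_eq_zero d φ hd, sub_zero]
    omega
  · have hdeq : φ.totalDegree = d := le_antisymm hφ (not_lt.1 hd)
    have hmem : d ∈ Finset.range (φ.totalDegree + 1) := Finset.mem_range.2 (by omega)
    have h := Finset.sum_erase_eq_sub (f := fun i => homogeneousComponent i φ) hmem
    rw [sum_homogeneousComponent] at h
    rw [← h]
    refine totalDegree_finsetSum_le fun i hi => ?_
    obtain ⟨hne, hi'⟩ := Finset.mem_erase.1 hi
    have hi'' := Finset.mem_range.1 hi'
    exact (homogeneousComponent_isHomogeneous i φ).totalDegree_le.trans (by omega)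

/-- **Degree count for one summand of a row polynomial**: if `deg φ + deg ψ ≤ e + 1` then
`deg ((∂ᵢφ)(ℓ) · ψ) ≤ e` for homogeneous linear forms `ℓ` (when `φ` is constant the product
vanishes). [folklore] -/
theorem totalDegree_bind₁_pderiv_mul_le {S : Type*} [CommRing S] {ℓ : σ → MvPolynomial τ S}
    (hℓ : ∀ j, (ℓ j).IsHomogeneous 1) (i : σ) {φ : MvPolynomial σ S} {ψ : MvPolynomial τ S} {e : ℕ}
    (h : φ.totalDegree + ψ.totalDegree ≤ e + 1) :
    (bind₁ ℓ (pderiv i φ) * ψ).totalDegree ≤ e := by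
  by_cases h0 : φ.totalDegree = 0
  · rw [(totalDegree_eq_zero_iff_eq_C).1 h0, pderiv_C, map_zero, zero_mul, totalDegree_zero]
    exact Nat.zero_le _
  · calc (bind₁ ℓ (pderiv i φ) * ψ).totalDegree
        ≤ (bind₁ ℓ (pderiv i φ)).totalDegree + ψ.totalDegree := totalDegree_mul _ _
      _ ≤ (φ.totalDegree - 1) + ψ.totalDegree :=
          Nat.add_le_add_right ((totalDegree_bind₁_le hℓ _).trans
            (Literature.RingTheory.MvPolynomial.Ruppert.totalDegree_pderiv_le i φ)) _
      _ ≤ e := by omega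

/-- Reading off a homogeneous component from a decomposition `Q = Q_top + Q_low` with `Q_top`
homogeneous of degree `k` and `deg Q_low < k`. [folklore] -/
theorem homogeneousComponent_eq_of_add {S : Type*} [CommRing S] {Q Qtop : MvPolynomial τ S} {k : ℕ}
    (htop : Qtop.IsHomogeneous k) (hlow : (Q - Qtop).totalDegree < k) :
    homogeneousComponent k Q = Qtop := by
  have hQ : Q = Qtop + (Q - Qtop) := by ring
  rw [hQ, map_add, homogeneousComponent_eq_self htop, homogeneousComponent_eq_zero _ _ hlow, add_zero]

/-- A linear form `Σ_l c_l X_l` is homogeneous of degree `1`. [folklore] -/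
theorem isHomogeneous_sum_C_mul_X {ι : Type*} (s : Finset ι) (c : ι → R) (v : ι → τ) :
    (∑ l ∈ s, C (c l) * X (v l) : MvPolynomial τ R).IsHomogeneous 1 :=
  IsHomogeneous.sum s _ 1 fun l _ => by
    simpa using (isHomogeneous_C τ (c l)).mul (isHomogeneous_X R (v l))

/-- A quadratic form `Σ_j Σ_k X_j X_k c_{jk}` is homogeneous of degree `2`. [folklore] -/
theorem isHomogeneous_sum_X_mul_X_mul_C {ι : Type*} [Fintype ι] (q : ι → ι → R) (v : ι → τ) :
    (∑ j, ∑ k, X (v j) * (X (v k) * C (q j k)) : MvPolynomial τ R).IsHomogeneous 2 :=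
  IsHomogeneous.sum _ _ 2 fun j _ => IsHomogeneous.sum _ _ 2 fun k _ => by
    simpa using (isHomogeneous_X R (v j)).mul ((isHomogeneous_X R (v k)).mul (isHomogeneous_C τ (q j k)))

/-- An affine form `C a + C ν * Σ_j X_j C c_j` has total degree `≤ 1`. [folklore] -/
theorem totalDegree_affine_le {ι : Type*} (s : Finset ι) (a ν : R) (c : ι → R) (v : ι → τ) :
    (C a + C ν * ∑ j ∈ s, X (v j) * C (c j) : MvPolynomial τ R).totalDegree ≤ 1 := by
  refine (totalDegree_add _ _).trans (max_le (by rw [totalDegree_C]; exact Nat.zero_le _) ?_)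
  refine (totalDegree_mul _ _).trans ?_
  rw [totalDegree_C, zero_add]
  refine totalDegree_finsetSum_le fun j _ => (totalDegree_mul _ _).trans ?_
  rw [totalDegree_C, add_zero]
  exact (isHomogeneous_X R (v j)).totalDegree_le

/-- Registered form (real coefficients, `Fin m` variables) of the degree drop under a partial
derivative, `deg ∂ᵢφ ≤ deg φ − 1` (the tree's `Ruppert.totalDegree_pderiv_le`). [folklore] -/
theorem totalDegree_pderiv_le_real :
    ∀ {m : ℕ} (i : Fin m) (φ : MvPolynomial (Fin m) ℝ),
      (MvPolynomial.pderiv i φ).totalDegree ≤ φ.totalDegree - 1 :=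
  fun i φ => Literature.RingTheory.MvPolynomial.Ruppert.totalDegree_pderiv_le i φ

end Summit.AnomalousDissipation.AnomalousDissipation.Theorems.MomentParityQuarticGate
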